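import Summits.BirchSwinnertonDyer.BirchSwinnertonDyer.Theorems.ResidualThetaTransportAtTwoThetaLayerLambdaCongruenceAtTwoStarFourCosets
import Literature.NumberTheory.EllipticCurves.ModularJacobianTorsionHeckeSelfDual
import HarnessLib

/-!
# Crux `ThetaLayerLambdaCongruenceAtTwo` (stmt-BirchSwinnertonDyer-20688, route ResidualThetaTransportAtTwo), line
# `birth` v9, stub (C3k): (K2) from the NAMED FACTS and ONE remaining input — mod-`2` multiplicity one in sub form at the
# explicit eigen-ideal `𝔪₀` (the conclusion of `buzzard2000_multiplicityOne_gamma0` at `𝔪₀`); with the maximality of `𝔪₀`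
# and `|𝕋/𝔪₀| = 2` PROVED (width seat bsd-wall-rtt-p3-w3 g3; `--supports stmt-BirchSwinnertonDyer-20688 --as helper`)

HONEST FRAMING. CONDITIONAL THEOREMS; named facts used by name: `eichlerShimura_depletedOptimalQuotient_periodLattice`,
`WeierstrassCurve.isIsogenous_iff_frobeniusTrace_eq`, `mazurKenku_exists_cyclic_isogeny`, `heckeSelfDual_torsionBy_J0`. The one
hypothesis that is not a named fact is `hsub : finrank_{𝕋/𝔪₀} J₀(L)[𝔪₀] = 2` — the conclusion of the landed fact
`buzzard2000_multiplicityOne_gamma0` (p598141) at `𝔪₀`, whose Galois-side hypotheses (the mod-`2` representation of `W` as a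
`ModPGaloisRep`, irreducible, non-scalar at `2`) are the assembler's to supply. Nothing here proves (C3k) or the crux; BSD is not
proved by any of this.

WHAT. `𝔪₀ = span{2, T_q − a_q(W) (q ∤ L prime), T_ℓ (ℓ ∣ L prime)} ⊆ 𝕋 = HeckeRing0 L 2` at the depleted level
`L = N·∏_{ℓ∈S} ℓ²` (`S ⊇ primes(N)` nonempty):
* §1 `exists_int_sub_mem_of_forall_T`: if every `T_p` is congruent to an integer modulo an ideal `𝔪`, so is every `t ∈ 𝕋`
  (`𝕋 = ℤ[T_p]`); `natCard_quotient_le_two`, `natCard_quotient_eq_two_of_ne_top`, `isMaximal_of_natCard_quotient_eq_two`: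
  with `2 ∈ 𝔪` the quotient `𝕋/𝔪` has at most two elements, exactly two iff `𝔪 ≠ ⊤`, and then `𝔪` is maximal.
* §2 `eigenIdeal_ne_top_of_facts`: `𝔪₀ ≠ ⊤` — because by B5 (`…StarAssemblyOfFacts`) some `{∞,(εγε)∞} − {∞,γ∞} ∈ Λ` is not
  in `𝔪₀Λ`; hence `|𝕋/𝔪₀| = 2` and `𝔪₀` is maximal (`isMaximal_eigenIdeal_of_facts`).
* §3 `kTwo_of_facts`: (K2) — for every additive subgroup `K ⊇ 2Λ, (T_q^∨ − a_q(W))Λ, U_ℓ^∨Λ,` cusp-negation differences,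
  `x, y ∈ Λ ∖ K ⇒ x − y ∈ K` — from the four named facts and `hsub`.

References: Lines/birth-C3k-plan.md Addendum 2; [DarmonDiamondTaylor1995] §1.6 Lemma 1.38, §4.1, §4.5; [Buzzard2000] Prop. 2.4.
-/

noncomputable section

-- justification: the `Summit.BirchSwinnertonDyer.BirchSwinnertonDyer.…` path repeats a component (route-file convention)
set_option linter.dupNamespace false

open scoped MatrixGroups ComplexConjugate ModularForm

open CongruenceSubgroup Complex WeierstrassCurve
open Literature.NumberTheory.EllipticCurves Literature.NumberTheory.EllipticCurves.ModularForms
open Literature.NumberTheory.EllipticCurves.Rank1Residual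

namespace Summit.BirchSwinnertonDyer.BirchSwinnertonDyer.Theorems.ThetaLayerLambdaCongruenceAtTwo

/-! ## §1. Ideals of `𝕋 = ℤ[T_p]` modulo which every `T_p` is an integer -/

section HeckeQuotient

variable {L : ℕ} [NeZero L]

/-- **If every `T_p` is congruent to an integer mod `𝔪`, so is every element of `𝕋 = ℤ[T_p : p prime]`.**
[cite: DarmonDiamondTaylor1995, §4.1 (p. 107)] -/
theorem exists_int_sub_mem_of_forall_T (𝔪 : Ideal (HeckeRing0 L 2))
    (hT : ∀ (p : ℕ) (hp : p.Prime), ∃ n : ℤ, HeckeRing0.T L 2 p hp - (n : HeckeRing0 L 2) ∈ 𝔪) (t : HeckeRing0 L 2) :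
    ∃ n : ℤ, t - (n : HeckeRing0 L 2) ∈ 𝔪 := by
  -- `t` is an element of the subalgebra `heckeRing0 L 2 = ℤ[T_p]` of `End(S₂)`; induct on its generation
  have key : ∀ (e : Module.End ℂ (CuspForm (Gamma0 L) 2)) (he : e ∈ Algebra.adjoin ℤ (heckeRing0Generators L 2)),
      ∃ n : ℤ, ((HeckeRing0.toSubalgebra L 2).symm ⟨e, he⟩ : HeckeRing0 L 2) - (n : HeckeRing0 L 2) ∈ 𝔪 := by
    intro e he
    induction he using Algebra.adjoin_induction with
    | mem x hx =>
      obtain ⟨p, hp, rfl⟩ := hx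
      exact hT p hp
    | algebraMap r =>
      refine ⟨r, ?_⟩
      have : ((HeckeRing0.toSubalgebra L 2).symm ⟨algebraMap ℤ _ r, Subalgebra.algebraMap_mem _ r⟩ : HeckeRing0 L 2) =
          (r : HeckeRing0 L 2) := by
        apply (HeckeRing0.toSubalgebra L 2).injective
        rw [RingEquiv.apply_symm_apply, map_intCast]
        refine Subtype.ext ?_
        rw [SubringClass.coe_intCast]
        exact eq_intCast (algebraMap ℤ (Module.End ℂ (CuspForm (Gamma0 L) 2))) r
      rw [this, sub_self]
      exact 𝔪.zero_mem
    | add x y hx hy ihx ihy =>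
      obtain ⟨a, ha⟩ := ihx
      obtain ⟨b, hb⟩ := ihy
      refine ⟨a + b, ?_⟩
      have e : ((HeckeRing0.toSubalgebra L 2).symm ⟨x + y, Subalgebra.add_mem _ hx hy⟩ : HeckeRing0 L 2) =
          (HeckeRing0.toSubalgebra L 2).symm ⟨x, hx⟩ + (HeckeRing0.toSubalgebra L 2).symm ⟨y, hy⟩ := by
        rw [← map_add]; rfl
      rw [e, Int.cast_add, add_sub_add_comm]
      exact 𝔪.add_mem ha hb
    | mul x y hx hy ihx ihy =>
      obtain ⟨a, ha⟩ := ihx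
      obtain ⟨b, hb⟩ := ihy
      refine ⟨a * b, ?_⟩
      have e : ((HeckeRing0.toSubalgebra L 2).symm ⟨x * y, Subalgebra.mul_mem _ hx hy⟩ : HeckeRing0 L 2) =
          (HeckeRing0.toSubalgebra L 2).symm ⟨x, hx⟩ * (HeckeRing0.toSubalgebra L 2).symm ⟨y, hy⟩ := by
        rw [← map_mul]; rfl
      set x' := ((HeckeRing0.toSubalgebra L 2).symm ⟨x, hx⟩ : HeckeRing0 L 2)
      set y' := ((HeckeRing0.toSubalgebra L 2).symm ⟨y, hy⟩ : HeckeRing0 L 2)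
      have e2 : x' * y' - ((a * b : ℤ) : HeckeRing0 L 2) = x' * (y' - b) + (x' - a) * b := by push_cast; ring
      rw [e, e2]
      exact 𝔪.add_mem (𝔪.mul_mem_left _ hb) (𝔪.mul_mem_right _ ha)
  exact key (HeckeRing0.toEnd L 2 t) (HeckeRing0.toEnd_mem L 2 t)

/-- With `2 ∈ 𝔪` and every `T_p ≡` an integer mod `𝔪`: every `t ∈ 𝕋` is `≡ 0` or `≡ 1` mod `𝔪`. [folklore] -/
theorem mk_eq_zero_or_one (𝔪 : Ideal (HeckeRing0 L 2)) (h2 : (2 : HeckeRing0 L 2) ∈ 𝔪)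
    (hT : ∀ (p : ℕ) (hp : p.Prime), ∃ n : ℤ, HeckeRing0.T L 2 p hp - (n : HeckeRing0 L 2) ∈ 𝔪) (t : HeckeRing0 L 2) :
    Ideal.Quotient.mk 𝔪 t = 0 ∨ Ideal.Quotient.mk 𝔪 t = 1 := by
  obtain ⟨n, hn⟩ := exists_int_sub_mem_of_forall_T 𝔪 hT t
  have ht : Ideal.Quotient.mk 𝔪 t = Ideal.Quotient.mk 𝔪 (n : HeckeRing0 L 2) := by
    rw [Ideal.Quotient.eq]; exact hn
  have h2n : ((2 * (n / 2) : ℤ) : HeckeRing0 L 2) ∈ 𝔪 := by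
    rw [Int.cast_mul, Int.cast_ofNat]; exact 𝔪.mul_mem_right _ h2
  rcases Int.emod_two_eq_zero_or_one n with h | h
  · left
    rw [ht, Ideal.Quotient.eq_zero_iff_mem]
    have : (n : HeckeRing0 L 2) = ((2 * (n / 2) : ℤ) : HeckeRing0 L 2) := by
      congr 1; omega
    rw [this]; exact h2n
  · right
    rw [ht, ← map_one (Ideal.Quotient.mk 𝔪), Ideal.Quotient.eq]
    have : (n : HeckeRing0 L 2) - 1 = ((2 * (n / 2) : ℤ) : HeckeRing0 L 2) := by
      rw [show (1 : HeckeRing0 L 2) = ((1 : ℤ) : HeckeRing0 L 2) by norm_num, ← Int.cast_sub]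
      congr 1; omega
    rw [this]; exact h2n

/-- `|𝕋/𝔪| ≤ 2` under the same hypotheses. [folklore] -/
theorem natCard_quotient_le_two (𝔪 : Ideal (HeckeRing0 L 2)) (h2 : (2 : HeckeRing0 L 2) ∈ 𝔪)
    (hT : ∀ (p : ℕ) (hp : p.Prime), ∃ n : ℤ, HeckeRing0.T L 2 p hp - (n : HeckeRing0 L 2) ∈ 𝔪) :
    Nat.card (HeckeRing0 L 2 ⧸ 𝔪) ≤ 2 := by
  classical
  let f : Bool → HeckeRing0 L 2 ⧸ 𝔪 := fun b ↦ if b then 1 else 0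
  have hf : Function.Surjective f := by
    intro q
    obtain ⟨t, rfl⟩ := Ideal.Quotient.mk_surjective q
    rcases mk_eq_zero_or_one 𝔪 h2 hT t with h | h
    · exact ⟨false, h.symm⟩
    · exact ⟨true, h.symm⟩
  haveI : Finite (HeckeRing0 L 2 ⧸ 𝔪) := Finite.of_surjective f hf
  calc Nat.card (HeckeRing0 L 2 ⧸ 𝔪) ≤ Nat.card Bool := Nat.card_le_card_of_surjective f hf
    _ = 2 := by simp

/-- `|𝕋/𝔪| = 2` when moreover `𝔪 ≠ ⊤`. [folklore] -/
theorem natCard_quotient_eq_two_of_ne_top (𝔪 : Ideal (HeckeRing0 L 2)) (h2 : (2 : HeckeRing0 L 2) ∈ 𝔪)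
    (hT : ∀ (p : ℕ) (hp : p.Prime), ∃ n : ℤ, HeckeRing0.T L 2 p hp - (n : HeckeRing0 L 2) ∈ 𝔪) (hne : 𝔪 ≠ ⊤) :
    Nat.card (HeckeRing0 L 2 ⧸ 𝔪) = 2 := by
  classical
  refine le_antisymm (natCard_quotient_le_two 𝔪 h2 hT) ?_
  haveI : Nontrivial (HeckeRing0 L 2 ⧸ 𝔪) := Ideal.Quotient.nontrivial_iff.mpr hne
  let f : Bool → HeckeRing0 L 2 ⧸ 𝔪 := fun b ↦ if b then 1 else 0
  have hf : Function.Surjective f := by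
    intro q
    obtain ⟨t, rfl⟩ := Ideal.Quotient.mk_surjective q
    rcases mk_eq_zero_or_one 𝔪 h2 hT t with h | h
    · exact ⟨false, h.symm⟩
    · exact ⟨true, h.symm⟩
  haveI : Finite (HeckeRing0 L 2 ⧸ 𝔪) := Finite.of_surjective f hf
  have h1 : 1 < Nat.card (HeckeRing0 L 2 ⧸ 𝔪) := Finite.one_lt_card_iff_nontrivial.mpr inferInstance
  omega

/-- A commutative ring with exactly two elements is a field; hence `𝔪` is maximal when `|𝕋/𝔪| = 2`. [folklore] -/
theorem isMaximal_of_natCard_quotient_eq_two (𝔪 : Ideal (HeckeRing0 L 2)) (hq : Nat.card (HeckeRing0 L 2 ⧸ 𝔪) = 2) :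
    𝔪.IsMaximal := by
  classical
  haveI : Finite (HeckeRing0 L 2 ⧸ 𝔪) := Nat.finite_of_card_ne_zero (by rw [hq]; norm_num)
  have hnt : Nontrivial (HeckeRing0 L 2 ⧸ 𝔪) := Finite.one_lt_card_iff_nontrivial.mp (by rw [hq]; norm_num)
  refine Ideal.Quotient.maximal_of_isField 𝔪 ?_
  refine ⟨hnt.exists_pair_ne, mul_comm, fun {a} ha ↦ ⟨a, ?_⟩⟩
  -- in a ring with two elements `{0, 1}`, a nonzero `a` is `1`
  haveI := hnt
  have huniv : ∀ b : HeckeRing0 L 2 ⧸ 𝔪, b = 0 ∨ b = 1 := by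
    intro b
    by_contra hb
    push Not at hb
    have h3 : ({0, 1, b} : Finset (HeckeRing0 L 2 ⧸ 𝔪)).card = 3 := by
      rw [Finset.card_insert_of_notMem, Finset.card_pair hb.2.symm]
      simp only [Finset.mem_insert, Finset.mem_singleton, not_or]
      exact ⟨zero_ne_one, hb.1.symm⟩
    haveI : Fintype (HeckeRing0 L 2 ⧸ 𝔪) := Fintype.ofFinite _
    have := Finset.card_le_univ ({0, 1, b} : Finset (HeckeRing0 L 2 ⧸ 𝔪))
    rw [h3, Fintype.card_eq_nat_card, hq] at this
    omega
  rcases huniv a with h | h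
  · exact absurd h ha
  · rw [h, mul_one]

end HeckeQuotient

/-! ## §2. The explicit eigen-ideal `𝔪₀` is proper (by B5), has `|𝕋/𝔪₀| = 2`, and is maximal -/

section EigenIdeal

variable {L : ℕ} [NeZero L]

/-- Every `T_p` is an integer modulo `𝔪₀ = span{2, T_q − a_q(W) (q ∤ L), T_ℓ (ℓ ∣ L)}`. [folklore] -/
theorem eigenIdeal_T_sub_int_mem (W : WeierstrassCurve ℚ) (p : ℕ) (hp : p.Prime) :
    ∃ n : ℤ, HeckeRing0.T L 2 p hp - (n : HeckeRing0 L 2) ∈ Ideal.span ({t : HeckeRing0 L 2 | t = 2 ∨ (∃ (q : ℕ) (hq : q.Prime), ¬ q ∣ L ∧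
          t = HeckeRing0.T L 2 q hq - (W.LFunction q : HeckeRing0 L 2)) ∨ (∃ (q : ℕ) (hq : q.Prime), q ∣ L ∧
          t = HeckeRing0.T L 2 q hq)}) := by
  by_cases hpL : p ∣ L
  · exact ⟨0, Ideal.subset_span (Or.inr (Or.inr ⟨p, hp, hpL, by rw [Int.cast_zero, sub_zero]⟩))⟩
  · exact ⟨W.LFunction p, Ideal.subset_span (Or.inr (Or.inl ⟨p, hp, hpL, rfl⟩))⟩

/-- **`𝔪₀ ≠ ⊤`**, by ITEM B5: some `{∞,(εγε)∞} − {∞,γ∞} ∈ Λ` does not lie in `𝔪₀Λ`, whereas `⊤ • Λ = Λ`. Facts: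
`eichlerShimura_depletedOptimalQuotient_periodLattice`, Faltings, Mazur–Kenku. [cite: CremonaAlgorithms1997, §2.10 (pp. 29–30)] -/
theorem eigenIdeal_ne_top_of_facts
    (hES : eichlerShimura_depletedOptimalQuotient_periodLattice)
    (hF : WeierstrassCurve.isIsogenous_iff_frobeniusTrace_eq) (hMK : mazurKenku_exists_cyclic_isogeny)
    (W : WeierstrassCurve ℚ) [W.IsElliptic] [W.IsGloballyMinimal] (hss : GoodSS W 2) (hΔ : W.Δ < 0)
    {N : ℕ} [NeZero N] {f : CuspForm (Gamma0 N) 2} (hf : IsNewformOf W f)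
    (S : Finset ℕ) (hS : ∀ ℓ ∈ S, ℓ.Prime) (hSne : S.Nonempty) (hSN : ∀ q : ℕ, q.Prime → q ∣ N → q ∈ S)
    (L : ℕ) [NeZero L] (hL : L = N * ∏ ℓ ∈ S, ℓ ^ 2) :
    Ideal.span ({t : HeckeRing0 L 2 | t = 2 ∨ (∃ (q : ℕ) (hq : q.Prime), ¬ q ∣ L ∧
          t = HeckeRing0.T L 2 q hq - (W.LFunction q : HeckeRing0 L 2)) ∨ (∃ (q : ℕ) (hq : q.Prime), q ∣ L ∧
          t = HeckeRing0.T L 2 q hq)}) ≠ ⊤ := by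
  classical
  obtain ⟨g, hg, hgall, hB5⟩ := exists_periodFunctional_iotaConj_sub_notMem_of_facts hES hF hMK W hss hΔ hf S hS hSne L hL
  have hLS : ∀ q : ℕ, q.Prime → (q ∣ L ↔ q ∈ S) := fun q hq ↦ by
    constructor
    · intro h
      by_contra hqS
      exact hqS (hSN q hq ((dvd_level_iff hS hL hq hqS).mp h))
    · exact fun h ↦ dvd_level_of_mem hL h
  have h2 : (2 : HeckeRing0 L 2) ∈ Ideal.span ({t : HeckeRing0 L 2 | t = 2 ∨ (∃ (q : ℕ) (hq : q.Prime), ¬ q ∣ L ∧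
          t = HeckeRing0.T L 2 q hq - (W.LFunction q : HeckeRing0 L 2)) ∨ (∃ (q : ℕ) (hq : q.Prime), q ∣ L ∧
          t = HeckeRing0.T L 2 q hq)}) := Ideal.subset_span (Or.inl rfl)
  have hb : ∀ (q : ℕ) (hq : q.Prime), (haveI : NeZero q := ⟨hq.ne_zero⟩; heckeT (Gamma0 L) 2 q g) =
      (((if q ∈ S then 0 else W.LFunction q : ℤ)) : ℂ) • g := fun q hq ↦ by
    rw [hgall q hq, hg q]
    by_cases hqS : q ∈ S
    · rw [if_pos ⟨q, hqS, dvd_rfl⟩, if_pos hqS, Int.cast_zero]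
    · rw [if_neg, if_neg hqS]
      rintro ⟨ℓ, hℓ, hd⟩
      exact hqS (((Nat.prime_dvd_prime_iff_eq (hS ℓ hℓ) hq).mp hd) ▸ hℓ)
  have h𝔪 : ∀ t ∈ Ideal.span ({t : HeckeRing0 L 2 | t = 2 ∨ (∃ (q : ℕ) (hq : q.Prime), ¬ q ∣ L ∧
          t = HeckeRing0.T L 2 q hq - (W.LFunction q : HeckeRing0 L 2)) ∨ (∃ (q : ℕ) (hq : q.Prime), q ∣ L ∧
          t = HeckeRing0.T L 2 q hq)}), ∃ e : ℤ, HeckeRing0.toEnd L 2 t g = ((2 * e : ℤ) : ℂ) • g := by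
    refine ideal_span_acts_even g (fun q ↦ if q ∈ S then 0 else W.LFunction q) hb _ fun t ht ↦ ?_
    rcases ht with rfl | ⟨q, hq, hqL, rfl⟩ | ⟨q, hq, hqL, rfl⟩
    · exact Or.inl rfl
    · refine Or.inr ⟨q, hq, ?_⟩
      rw [if_neg (fun h ↦ hqL ((hLS q hq).mpr h))]
    · refine Or.inr ⟨q, hq, ?_⟩
      rw [if_pos ((hLS q hq).mp hqL), Int.cast_zero, sub_zero]
  obtain ⟨γ, hγ⟩ := hB5 _ h2 h𝔪
  intro htop
  apply hγ
  rw [htop, Submodule.top_smul]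
  exact (mem_periodHomologyHecke L).mpr (sub_mem (periodFunctional_mem_periodHomology L _) (periodFunctional_mem_periodHomology L γ))

/-- **`|𝕋/𝔪₀| = 2` and `𝔪₀` is maximal** (from `𝔪₀ ≠ ⊤`, `2 ∈ 𝔪₀`, and `T_p ≡` integers mod `𝔪₀`).
[cite: DarmonDiamondTaylor1995, §4.1 (p. 107)] -/
theorem natCard_quotient_eigenIdeal_of_facts
    (hES : eichlerShimura_depletedOptimalQuotient_periodLattice)
    (hF : WeierstrassCurve.isIsogenous_iff_frobeniusTrace_eq) (hMK : mazurKenku_exists_cyclic_isogeny)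
    (W : WeierstrassCurve ℚ) [W.IsElliptic] [W.IsGloballyMinimal] (hss : GoodSS W 2) (hΔ : W.Δ < 0)
    {N : ℕ} [NeZero N] {f : CuspForm (Gamma0 N) 2} (hf : IsNewformOf W f)
    (S : Finset ℕ) (hS : ∀ ℓ ∈ S, ℓ.Prime) (hSne : S.Nonempty) (hSN : ∀ q : ℕ, q.Prime → q ∣ N → q ∈ S)
    (L : ℕ) [NeZero L] (hL : L = N * ∏ ℓ ∈ S, ℓ ^ 2) :
    Nat.card (HeckeRing0 L 2 ⧸ Ideal.span ({t : HeckeRing0 L 2 | t = 2 ∨ (∃ (q : ℕ) (hq : q.Prime), ¬ q ∣ L ∧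
          t = HeckeRing0.T L 2 q hq - (W.LFunction q : HeckeRing0 L 2)) ∨ (∃ (q : ℕ) (hq : q.Prime), q ∣ L ∧
          t = HeckeRing0.T L 2 q hq)})) = 2 ∧ (Ideal.span ({t : HeckeRing0 L 2 | t = 2 ∨ (∃ (q : ℕ) (hq : q.Prime), ¬ q ∣ L ∧
          t = HeckeRing0.T L 2 q hq - (W.LFunction q : HeckeRing0 L 2)) ∨ (∃ (q : ℕ) (hq : q.Prime), q ∣ L ∧
          t = HeckeRing0.T L 2 q hq)})).IsMaximal := by
  have hq := natCard_quotient_eq_two_of_ne_top (Ideal.span ({t : HeckeRing0 L 2 | t = 2 ∨ (∃ (q : ℕ) (hq : q.Prime), ¬ q ∣ L ∧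
          t = HeckeRing0.T L 2 q hq - (W.LFunction q : HeckeRing0 L 2)) ∨ (∃ (q : ℕ) (hq : q.Prime), q ∣ L ∧
          t = HeckeRing0.T L 2 q hq)})) (Ideal.subset_span (Or.inl rfl))
    (eigenIdeal_T_sub_int_mem W) (eigenIdeal_ne_top_of_facts hES hF hMK W hss hΔ hf S hS hSne hSN L hL)
  exact ⟨hq, isMaximal_of_natCard_quotient_eq_two _ hq⟩

end EigenIdeal

/-! ## §3. (K2) from the four named facts and multiplicity one (sub form) at `𝔪₀` -/

section KTwo

variable {L : ℕ}

/-- **(K2) from the named facts.** `W/ℚ` globally minimal, good supersingular at `2`, `Δ_W < 0`; newform `f` of level `N`;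
`S ⊇ primes(N)` a nonempty finite set of primes; `L = N·∏_{ℓ∈S} ℓ²`; `𝔪₀` the explicit eigen-ideal. ASSUME the conclusion of
`buzzard2000_multiplicityOne_gamma0` at `𝔪₀`: `finrank_{𝕋/𝔪₀} J₀(L)[𝔪₀] = 2` (`𝔪₀` IS maximal with `|𝕋/𝔪₀| = 2`, §2). Then for
every additive subgroup `K` of `S₂(Γ₀(L))^∨` containing `2x`, `T_q^∨x − a_q(W)x` (`q ∤ L`), `U_ℓ^∨x` (`ℓ ∣ L`) for `x ∈ Λ` and all
`{∞,(εγε)∞} − {∞,γ∞}`: `x, y ∈ Λ ∖ K ⇒ x − y ∈ K`. Named facts: `eichlerShimura_depletedOptimalQuotient_periodLattice`,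
`isIsogenous_iff_frobeniusTrace_eq`, `mazurKenku_exists_cyclic_isogeny`, `heckeSelfDual_torsionBy_J0`.
[cite: DarmonDiamondTaylor1995, §1.6 Lemma 1.38 and §4.5 Thm. 4.26] -/
theorem kTwo_of_facts
    (hES : eichlerShimura_depletedOptimalQuotient_periodLattice)
    (hF : WeierstrassCurve.isIsogenous_iff_frobeniusTrace_eq) (hMK : mazurKenku_exists_cyclic_isogeny)
    (hSD : heckeSelfDual_torsionBy_J0)
    (W : WeierstrassCurve ℚ) [W.IsElliptic] [W.IsGloballyMinimal] (hss : GoodSS W 2) (hΔ : W.Δ < 0)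
    {N : ℕ} [NeZero N] {f : CuspForm (Gamma0 N) 2} (hf : IsNewformOf W f)
    (S : Finset ℕ) (hS : ∀ ℓ ∈ S, ℓ.Prime) (hSne : S.Nonempty) (hSN : ∀ q : ℕ, q.Prime → q ∣ N → q ∈ S)
    (L : ℕ) [NeZero L] (hL : L = N * ∏ ℓ ∈ S, ℓ ^ 2)
    (hsub : Module.finrank (HeckeRing0 L 2 ⧸ Ideal.span ({t : HeckeRing0 L 2 | t = 2 ∨ (∃ (q : ℕ) (hq : q.Prime), ¬ q ∣ L ∧
          t = HeckeRing0.T L 2 q hq - (W.LFunction q : HeckeRing0 L 2)) ∨ (∃ (q : ℕ) (hq : q.Prime), q ∣ L ∧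
          t = HeckeRing0.T L 2 q hq)}))
      (Submodule.torsionBySet (HeckeRing0 L 2) (J0 L) (Ideal.span ({t : HeckeRing0 L 2 | t = 2 ∨ (∃ (q : ℕ) (hq : q.Prime), ¬ q ∣ L ∧
          t = HeckeRing0.T L 2 q hq - (W.LFunction q : HeckeRing0 L 2)) ∨ (∃ (q : ℕ) (hq : q.Prime), q ∣ L ∧
          t = HeckeRing0.T L 2 q hq)}))) = 2)
    (K : AddSubgroup (Module.Dual ℂ (CuspForm (Gamma0 L) 2)))
    (h2K : ∀ x ∈ periodHomology L, (2 : ℂ) • x ∈ K)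
    (hTK : ∀ (q : ℕ) (hq : q.Prime), ¬ q ∣ L → ∀ x ∈ periodHomology L,
      (haveI : NeZero q := ⟨hq.ne_zero⟩; heckeT (Gamma0 L) 2 q).dualMap x - (W.LFunction q : ℂ) • x ∈ K)
    (hUK : ∀ (q : ℕ) (hq : q.Prime), q ∣ L → ∀ x ∈ periodHomology L,
      (haveI : NeZero q := ⟨hq.ne_zero⟩; heckeT (Gamma0 L) 2 q).dualMap x ∈ K)
    (hcK : ∀ γ : Gamma0 L, periodFunctional L ⟨iotaConj (γ : SL(2, ℤ)), iotaConj_coe_mem_gamma0 γ⟩ - periodFunctional L γ ∈ K)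
    {x y : Module.Dual ℂ (CuspForm (Gamma0 L) 2)} (hx : x ∈ periodHomology L) (hy : y ∈ periodHomology L)
    (hxK : x ∉ K) (hyK : y ∉ K) : x - y ∈ K := by
  obtain ⟨hq, hmax⟩ := natCard_quotient_eigenIdeal_of_facts hES hF hMK W hss hΔ hf S hS hSne hSN L hL
  haveI := hmax
  obtain ⟨B, hbal, hleft, -⟩ := hSD L 2
  exact kTwo_of_multiplicityOneSub_of_facts hES hF hMK W hss hΔ hf S hS hSne hSN L hL hq hsub B hbal hleft K h2K hTK hUK hcK
    hx hy hxK hyK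

end KTwo


end Summit.BirchSwinnertonDyer.BirchSwinnertonDyer.Theorems.ThetaLayerLambdaCongruenceAtTwo

end
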